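import Summits.AtomisticToContinuum.Crystallization.Theorems.ThreeConeCertificateExactCertificateFieldInvisible

/-!
# `ExactCertificate` (stmt-AtomisticToContinuum-11959), line `closure-makes-nogap-exact`:
# the LP rows of a witness at every probe point (`stub_nearDefect`)

Support file for the crux `ThreeConeCertificate.ExactCertificate` (necessity side).  Let
`(P, ρ, c, g, U, f)` be a WITNESS: `IsSplit ρ c g U f` ((S1) `V_LJ = g + U + f` on `(0,∞)`,
(S2) `U ≥ 0`, (S3) `g ≡ 0` on `[ρ,∞)`, (S4) `f` radially of positive type, (S5) `g` is
`c`-stable) with `c + f 0 / 2 ≤ −e(P)`, and assume `0 < ρ`.  Fix a probe point `w ∈ ℝ³` and let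
`s = {y ∈ P : dist w y < ρ}` — a finite set (`near_exists_finset`; a periodic configuration is
locally finite, `PeriodicConfiguration.finite_inter_points`).  By the invisibility theorem
(`Field.invisible_of_isSplit`: the `f`-field of the whole crystal vanishes at every point of
space) the vanishing field splits as `0 = Σ_{y ∈ s} f(dist w y) + Σ'_{y ∉ s} f(dist w y)`; at the
far points `dist w y ≥ ρ > 0`, where `f ≤ V_LJ` (`IsSplit.f_le_tail`) and the Lennard-Jones
family is summable (`PeriodicConfiguration.summable_lennardJones_dist_three`), so

* `0 ≤ Σ_{y ∈ s} f(dist w y) + Σ'_{y ∉ s} V_LJ(dist w y)` for every `w ∈ ℝ³` (`near_row_nonneg`);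
* equality holds for `w ∈ P` (`near_row_eq_zero`), because `f = V_LJ` on the distance set of `P`
  beyond `ρ` (`Slackness.f_eq_lennardJones_of_mem_points`, i.e. complementary slackness `U = 0`
  on `D_P`).

These are the "LP rows" every witness `f` must satisfy; only the values of `f` on `[0, ρ)` enter.
Together they give the registered stub `stub_nearDefect` of the line skeleton (signature
verbatim).  All `[folklore]`.
-/

noncomputable section

namespace Summit.AtomisticToContinuum.Crystallization.Theorems.ThreeConeCertificateExactCertificate.Field

open Literature.MathematicalPhysics.StatisticalMechanics
open Summit.AtomisticToContinuum.Crystallization.Theorems.ChargedEnergyGapNegative (E3)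
open Summit.AtomisticToContinuum.Crystallization.Theorems.ExactCertificateNegative (IsSplit)
open scoped BigOperators

/-! ## The near points of a probe -/

/-- **The near points form a finite set.** For a periodic configuration `P` of `ℝ³`, a probe
point `w` and a radius `ρ`, there is a `Finset` of points of `P` consisting exactly of the points
at distance `< ρ` from `w` (a periodic configuration is locally finite). [folklore] -/
theorem near_exists_finset (P : PeriodicConfiguration 3) (w : E3) (ρ : ℝ) :
    ∃ s : Finset P.points, ∀ y : P.points, y ∈ s ↔ dist w (y : E3) < ρ := by
  have hfin : ((fun y : P.points => (y : E3)) ⁻¹' (Metric.ball w ρ ∩ P.points)).Finite :=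
    (P.finite_inter_points Metric.isBounded_ball).preimage Subtype.val_injective.injOn
  refine ⟨hfin.toFinset, fun y => ?_⟩
  rw [Set.Finite.mem_toFinset, Set.mem_preimage, Set.mem_inter_iff, Metric.mem_ball']
  exact ⟨fun hy => hy.1, fun hy => ⟨hy, y.2⟩⟩

/-- Outside the near set the distance to the probe is at least `ρ`. [folklore] -/
theorem near_le_dist_of_not_mem {P : PeriodicConfiguration 3} {w : E3} {ρ : ℝ}
    {s : Finset P.points} (hs : ∀ y : P.points, y ∈ s ↔ dist w (y : E3) < ρ)
    (y : {y : P.points // y ∉ s}) : ρ ≤ dist w ((y : P.points) : E3) :=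
  not_lt.1 fun hlt => y.2 ((hs y.1).2 hlt)

/-- Outside the near set of a probe with `0 < ρ` the distance to the probe is positive.
[folklore] -/
theorem near_dist_pos_of_not_mem {P : PeriodicConfiguration 3} {w : E3} {ρ : ℝ} (hρ : 0 < ρ)
    {s : Finset P.points} (hs : ∀ y : P.points, y ∈ s ↔ dist w (y : E3) < ρ)
    (y : {y : P.points // y ∉ s}) : 0 < dist w ((y : P.points) : E3) :=
  hρ.trans_le (near_le_dist_of_not_mem hs y)

/-- Outside the near set of a probe with `0 < ρ` the points differ from the probe. [folklore] -/
theorem near_ne_of_not_mem {P : PeriodicConfiguration 3} {w : E3} {ρ : ℝ} (hρ : 0 < ρ)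
    {s : Finset P.points} (hs : ∀ y : P.points, y ∈ s ↔ dist w (y : E3) < ρ)
    (y : {y : P.points // y ∉ s}) : ((y : P.points) : E3) ≠ w := fun heq => by
  have h := near_dist_pos_of_not_mem hρ hs y
  rw [heq, dist_self] at h
  exact lt_irrefl 0 h

/-- The far points of a probe with `0 < ρ` embed into the points of `P` other than the probe.
[folklore] -/
theorem near_injective_far {P : PeriodicConfiguration 3} {w : E3} {ρ : ℝ} (hρ : 0 < ρ)
    {s : Finset P.points} (hs : ∀ y : P.points, y ∈ s ↔ dist w (y : E3) < ρ) :
    Function.Injective fun y : {y : P.points // y ∉ s} =>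
      (⟨((y : P.points) : E3), (y : P.points).2, near_ne_of_not_mem hρ hs y⟩ :
        {q : E3 // q ∈ P.points ∧ q ≠ w}) := by
  intro y y' hyy'
  have h1 := congrArg Subtype.val hyy'
  exact Subtype.ext (Subtype.ext h1)

/-- **The far Lennard-Jones family is summable**: `y ↦ V_LJ(dist w y)` is summable over the
points of `P` outside the near set of a probe with `0 < ρ` (a subfamily of the absolutely
convergent Lennard-Jones lattice sum over `P ∖ {w}`). [folklore] -/
theorem near_summable_lennardJones_far (P : PeriodicConfiguration 3) {w : E3} {ρ : ℝ}
    (hρ : 0 < ρ) {s : Finset P.points} (hs : ∀ y : P.points, y ∈ s ↔ dist w (y : E3) < ρ) :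
    Summable fun y : {y : P.points // y ∉ s} => lennardJones (dist w ((y : P.points) : E3)) := by
  have h1 := (P.summable_lennardJones_dist_three w).comp_injective (near_injective_far hρ hs)
  exact h1

/-! ## The LP rows -/

/-- **The LP row of a witness at a general probe.** For a witness `(P, ρ, c, g, U, f)` with
`0 < ρ`, a probe `w ∈ ℝ³` and its near set `s = {y ∈ P : dist w y < ρ}`:
`0 ≤ Σ_{y ∈ s} f(dist w y) + Σ'_{y ∉ s} V_LJ(dist w y)` (invisibility, and `f ≤ V_LJ` beyond
`ρ`). [folklore] -/
theorem near_row_nonneg {P : PeriodicConfiguration 3} {ρ c : ℝ} {g U f : ℝ → ℝ}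
    (h : IsSplit ρ c g U f) (hv : c + f 0 / 2 ≤ -(P.energyPerParticle lennardJones))
    (hρ : 0 < ρ) {w : E3} {s : Finset P.points}
    (hs : ∀ y : P.points, y ∈ s ↔ dist w (y : E3) < ρ) :
    0 ≤ ∑ y ∈ s, f (dist w (y : E3)) +
      ∑' y : {y : P.points // y ∉ s}, lennardJones (dist w ((y : P.points) : E3)) := by
  have hinv := invisible_of_isSplit h hv w
  have hsplit : ∑ y ∈ s, f (dist w (y : E3)) +
      ∑' y : {y : P.points // y ∉ s}, f (dist w ((y : P.points) : E3)) = 0 := by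
    rw [hinv.summable.sum_add_tsum_subtype_compl s, hinv.tsum_eq]
  have hsf : Summable fun y : {y : P.points // y ∉ s} => f (dist w ((y : P.points) : E3)) :=
    hinv.summable.subtype fun y : P.points => y ∉ s
  have hle : ∑' y : {y : P.points // y ∉ s}, f (dist w ((y : P.points) : E3)) ≤
      ∑' y : {y : P.points // y ∉ s}, lennardJones (dist w ((y : P.points) : E3)) :=
    hsf.tsum_le_tsum (fun y => h.f_le_tail (near_le_dist_of_not_mem hs y)
      (near_dist_pos_of_not_mem hρ hs y)) (near_summable_lennardJones_far P hρ hs)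
  linarith

/-- **The LP row of a witness at a probe on the crystal.** If moreover `w ∈ P`, the row is
tight: `Σ_{y ∈ s} f(dist w y) + Σ'_{y ∉ s} V_LJ(dist w y) = 0` (invisibility, and `f = V_LJ` on
the distance set of `P` beyond `ρ`). [folklore] -/
theorem near_row_eq_zero {P : PeriodicConfiguration 3} {ρ c : ℝ} {g U f : ℝ → ℝ}
    (h : IsSplit ρ c g U f) (hv : c + f 0 / 2 ≤ -(P.energyPerParticle lennardJones))
    (hρ : 0 < ρ) {w : E3} (hw : w ∈ P.points) {s : Finset P.points}
    (hs : ∀ y : P.points, y ∈ s ↔ dist w (y : E3) < ρ) :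
    ∑ y ∈ s, f (dist w (y : E3)) +
      ∑' y : {y : P.points // y ∉ s}, lennardJones (dist w ((y : P.points) : E3)) = 0 := by
  have hinv := invisible_of_isSplit h hv w
  have heq : ∑' y : {y : P.points // y ∉ s}, lennardJones (dist w ((y : P.points) : E3)) =
      ∑' y : {y : P.points // y ∉ s}, f (dist w ((y : P.points) : E3)) :=
    tsum_congr fun y => (Slackness.f_eq_lennardJones_of_mem_points h hv hw (y : P.points).2
      (near_ne_of_not_mem hρ hs y).symm (near_le_dist_of_not_mem hs y)).symm
  rw [heq, hinv.summable.sum_add_tsum_subtype_compl s, hinv.tsum_eq]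

/-- **Registered stub `stub_nearDefect` of crux item stmt-AtomisticToContinuum-11959** (line
`closure-makes-nogap-exact`, necessity side; signature verbatim): the LP rows at every probe
point.  For a witness `(P, ρ, c, g, U, f)` with `0 < ρ` and every `w ∈ ℝ³`, with
`s = {y ∈ P : dist w y < ρ}` (finite), `0 ≤ Σ_{y ∈ s} f(dist w y) + Σ'_{y ∉ s} V_LJ(dist w y)`,
with equality for `w ∈ P`. [folklore] -/
theorem stub_nearDefect : ∀ (P : PeriodicConfiguration 3) (ρ c : ℝ) (g U f : ℝ → ℝ),
    Summit.AtomisticToContinuum.Crystallization.Theorems.ExactCertificateNegative.IsSplit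
        ρ c g U f →
    c + f 0 / 2 ≤ -(P.energyPerParticle lennardJones) → 0 < ρ →
    ∀ w : EuclideanSpace ℝ (Fin 3), ∃ s : Finset P.points,
      (∀ y : P.points, y ∈ s ↔ dist w (y : EuclideanSpace ℝ (Fin 3)) < ρ) ∧
      0 ≤ ∑ y ∈ s, f (dist w (y : EuclideanSpace ℝ (Fin 3))) +
          ∑' y : {y : P.points // y ∉ s},
            lennardJones (dist w (y : EuclideanSpace ℝ (Fin 3))) ∧
      (w ∈ P.points →
        ∑ y ∈ s, f (dist w (y : EuclideanSpace ℝ (Fin 3))) +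
          ∑' y : {y : P.points // y ∉ s},
            lennardJones (dist w (y : EuclideanSpace ℝ (Fin 3))) = 0) := by
  intro P ρ c g U f h hv hρ w
  obtain ⟨s, hs⟩ := near_exists_finset P w ρ
  exact ⟨s, hs, near_row_nonneg h hv hρ hs, fun hw => near_row_eq_zero h hv hρ hw hs⟩

end Summit.AtomisticToContinuum.Crystallization.Theorems.ThreeConeCertificateExactCertificate.Field

end
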